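import Mathlib
import Literature.MathematicalPhysics.QuantumFieldTheory.Balaban1983to89.B6Prop22OneScaleTorus
import Literature.MathematicalPhysics.QuantumFieldTheory.Balaban1983to89.B6Lemma21OneScaleTorus

/-!
# `Balaban1983to89.B6Lemma21TowerTorus` — T. Bałaban, *Propagators and renormalization transformations for lattice gauge
theories. II*, Commun. Math. Phys. **96** (1984) 223–250 [Balaban1984PropagatorsII]: **Lemma 2.1 (2.60)–(2.63), VERBATIM
(`B6.Lemma21Printed`), on the one-scale torus family SITE VERSION ON THE TOWER CARRIERS** — the family of this seat's
`…B6Prop22OneScaleTorus` — and the joint statement **Lemma 2.1 ∧ Proposition 2.2, both verbatim census Props, on ONE family**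
(the Proposition 2.2 conjunct inhabited by the GENUINE `G′ = Δ′_a⁻¹ = (−Δ^η + m² + a_KQ′_K*Q′_K)⁻¹`)

statement-level skeleton of published theorems with citation tags; proofs where landed; nothing here is a claim about the Yang–Mills mass gap.
PDF held: `paper:balaban1984-cmp96-propagators-rt-ii` (journal page = PDF page + 222); pp. 233–235 [PDF 11–13] read this session; the
verbatim statement of Lemma 2.1 is the docstring of `B6.Lemma21Printed` (certified against the ×2 renders by the B6 block reader r03).

CITATION HEADER (cell `lit-balaban`, Phase-2 proof seat `p01` (gen 6) = unit `lit-balaban-p01`, HOME `run/shared/lean/pub/lit-balaban/`,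
free-target protocol G.5-34(d); companion of this seat's `…B6Prop22OneScaleTorus` (p258648), answering the B6 owner r03's note of
2026-08-21T07:30Z that the cell's edge theorems (`B6Ineq288Edge`, `B6RandomWalk.lemma21_full`) want Lemma 2.1 and Proposition 2.2 on
the SAME geometry family).  SKELETON row **`B6.Lem2.1`** (head «refuted-as-printed (+proved repaired on towers)», owner r03; this file
is a further one-scale MODEL INSTANCE, no head change) and row **`B6.Prop2.2`** (the conjunction).  Imported, not modified:
`…B6Prop22OneScaleTorus` (this seat: `oneScaleGeo`, `T1`, `torusGp`, `Index`, `prop22Printed_oneScaleTorus`), `…B6Lemma21OneScaleTorus`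
(r03 g6, p254893: the lattice sums `sum_exp_circAbs_le_c0` — Σ_{j∈ℤ/N}e^{−αδ₀dist(a−j,Nℤ)} ≤ c₀(α) —, `c0_le_c0_half`, `exists_cond259`;
the same Lemma on the `Idx`-carrier family of gen 5), through them `…B6RandomWalk` (`Ineq260`–`Ineq263`, `Triangle254`,
`lemma21Printed_iff`, `lemma21_full`), `…B4Sect5Torus` (`ccoord`, `ccoord_cast`, `ccoord_triangle`, `ccoord_symm`), `…B5Ineq137Torus`
(`toT`, `Nv`, `siteEquiv : Site P j ≃ TSite`).

WHAT THE PAPER PRINTS.  p. 234 [PDF 12], Lemma 2.1 verbatim = docstring of `B6.Lemma21Printed` (*"For the numbers α, 0 < α < 1, c₁(α)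
= 12c₀^d(½α), and RM satisfying (2.59) we have e^{−αδ₀d(y,y′)} ≤ e^{−αδ₀RM max{|j−j′|−1,0}}, y ∈ Λ_j, y′ ∈ Λ_{j′}, (2.60)
sup_{y∈𝔅} Σ_{y′∈𝔅} e^{−αδ₀d(y,y′)} ≤ c₁(α), (2.61) hence … (2.62) and … (2.63)"*); p. 233: c₀(α) = Σ_{z∈ℤ}e^{−αδ₀|z|} and
*"(2.54) … This is of course the triangle inequality for our distance"*; p. 235 [PDF 13]: *"If we have one scale, i.e. Λ_k =
T₁^{(k)}, then the operator is a unit lattice operator"*.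

THE READING (that of `…B6Prop22OneScaleTorus`, stated there once): `Λ_K = T₁^{(K)} = Site P K` (the tower carriers of the cell's
`Params`, `2L^m` sites per direction), every site at scale K, `d(y, y′) = T1 P K y y′` = the periodic ℓ¹ distance (on ONE scale the
admissible contours of (2.46) are chains of unit-lattice bonds), (2.1)–(2.2) void, `Mb`, `R` parameters.

WHAT IS PROVED HERE (theorems only; 0 sorry, 0 defs, 0 named facts; axioms standard).
§1 `T1_triangle` ((2.54) for the one-scale distance), `T1_symm`, `T1_nonneg`, `triangle254_oneScaleGeo`, `dist_symm_oneScaleGeo`,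
  `oneScaleGeo_side_conditions` (the geometric hypotheses of the cell's edge theorems, bundled).
§2 **`sum_exp_T1_le`** — `Σ_{y′∈T^{(j)}} e^{−αδ₀|y − y′|₁} ≤ c₀(α)^d`: the exponential of the ℓ¹ distance factorises over the `d`
  coordinates, each factor is r03's `sum_exp_circAbs_le_c0`.
§3 `ineq260_oneScaleGeo` ((2.60) on one scale: void), **`ineq261_oneScaleGeo`** ((2.61) WITH THE PRINTED c₁(α) = 12c₀(½α)^d, every
  `α, δ₀` with `αδ₀ > 0`, uniformly in the volume), **`lemma21Printed_towerTorus`** — `B6.Lemma21Printed d δ₀ (oneScaleGeo-family)` for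
  EVERY `δ₀ > 0` and every `L`, `lemma21_full_towerTorus` ((2.60)–(2.63) through `B6RandomWalk.lemma21_full`), `towerTorus_meets_cond259`
  (non-vacuity of (2.59) on the family), and **`lemma21_and_prop22_oneScaleTorus`** — `B6.Lemma21Printed d δ₀ geo ∧ B6.Prop22Printed geo
  torusGp` on ONE family `geo = fun i : Index d L => oneScaleGeo i.P i.Mb i.R` (d ≥ 1, odd L > 1, a > 0, m² ≥ 0, δ₀ > 0).
HONEST SCOPE.  One scale only (the multi-scale Lemma — levels, the metric (2.46) across levels, (2.57)–(2.59) — is r03's tower work and is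
refuted AS PRINTED for d ≥ 3 / d = 2 on towers; on one scale (2.61) holds with the printed constant for every α, δ₀ > 0 and (2.59) is not
even used); scalar model, torus sizes of the tower; the Prop. 2.2 conjunct is exactly `B6Prop22OneScaleTorus.prop22Printed_oneScaleTorus`
(its honest scope applies).  The third verbatim conjunct of the gen-5/r03 triple, Proposition 2.3, lives on the `Idx`-carrier family
(`B6Prop23OneScaleTorus`); carrying it to the tower carriers needs the `(Q′G′²Q′*)⁻¹` bridge `Site ↔ Idx`, NOT done here.
-/

namespace Literature.MathematicalPhysics.QuantumFieldTheory.Balaban1983to89.B6Lemma21TowerTorus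

open Finset
open B4TorusKernel.MultiPeriod (circAbs)
open B4Sect5Torus (ccoord ccoord_cast ccoord_triangle ccoord_symm)
open B5Ineq137Torus (toT Nv Nv_pos siteEquiv)
open B6Prop22OneScaleTorus (T1 oneScaleGeo torusGp Index prop22Printed_oneScaleTorus)
open B6Lemma21OneScaleTorus (sum_exp_circAbs_le_c0 c0_le_c0_half exists_cond259)
open B6RandomWalk (Ineq260 Ineq261 Ineq262 Ineq263 Triangle254 lemma21Printed_iff lemma21_full)

noncomputable section

variable (P : Params)

/-! ## §1. (2.54) for the one-scale distance `|y − y′|₁` of the tower tori -/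

/-- **(2.54) on one scale**: the periodic ℓ¹ distance of `T^{(j)} = Site P j` satisfies the triangle inequality (coordinatewise
`B4Sect5Torus.ccoord_triangle`). [cite: Balaban1984PropagatorsII, (2.54) p.233 «This is of course the triangle inequality for our distance»] -/
theorem T1_triangle (j : ℕ) (x y z : Site P j) : T1 P j x z ≤ T1 P j x y + T1 P j y z := by
  unfold T1
  have h : ∑ μ, ccoord (Nv P j) (toT x) (toT z) μ ≤
      ∑ μ, ccoord (Nv P j) (toT x) (toT y) μ + ∑ μ, ccoord (Nv P j) (toT y) (toT z) μ := by
    rw [← Finset.sum_add_distrib]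
    exact Finset.sum_le_sum fun μ _ => ccoord_triangle (Nv_pos P j) _ _ _ μ
  exact_mod_cast h

/-- `|y − y′|₁ = |y′ − y|₁` (the one-scale distance (2.46) is symmetric). [cite: Balaban1984PropagatorsII, (2.46) p.231; bookkeeping] -/
theorem T1_symm (j : ℕ) (x y : Site P j) : T1 P j x y = T1 P j y x := by
  unfold T1
  congr 1
  exact Finset.sum_congr rfl fun μ _ => ccoord_symm (Nv_pos P j) _ _ μ

/-- `0 ≤ |y − y′|₁`. [cite: Balaban1984PropagatorsII, (2.46) p.231; bookkeeping] -/
theorem T1_nonneg (j : ℕ) (x y : Site P j) : 0 ≤ T1 P j x y := by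
  unfold T1; positivity

/-- **`Triangle254` of the one-scale torus geometry (site version on the tower carriers)** — the hypothesis (2.54) of the cell's
chain lemmas (`B6RandomWalk.lemma21_full`, `B6Ineq288Edge.ineq288_of_printed`). [cite: Balaban1984PropagatorsII, (2.54) p.233] -/
theorem triangle254_oneScaleGeo (Mb R : ℕ) : Triangle254 (oneScaleGeo P Mb R) := fun a b c => T1_triangle P P.K a b c

/-- the distance of the one-scale torus geometry is symmetric (hypothesis `hsymm` of `B6Ineq288Edge.ineq288_of_printed`).
[cite: Balaban1984PropagatorsII, (2.46) p.231; bookkeeping] -/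
theorem dist_symm_oneScaleGeo (Mb R : ℕ) (a b : (oneScaleGeo P Mb R).Site) :
    (oneScaleGeo P Mb R).dist a b = (oneScaleGeo P Mb R).dist b a := T1_symm P P.K a b

/-- **The side conditions of the cell's edge theorems hold on every member of the family**: (2.54) (`Triangle254`), `d ≥ 0`,
`d` symmetric, `1 ≤ L`, `0 < η` — the geometric hypotheses `htri`, `hdist`, `hsymm`, `hL`, `hη` of `B6Ineq288Edge.ineq288_of_printed` ∕
`B6RandomWalk.lemma21_full` for the one-scale torus geometry. [cite: Balaban1984PropagatorsII, (2.46) p.231, (2.54) p.233; bookkeeping] -/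
theorem oneScaleGeo_side_conditions (Mb R : ℕ) :
    Triangle254 (oneScaleGeo P Mb R) ∧ (∀ y y' : (oneScaleGeo P Mb R).Site, 0 ≤ (oneScaleGeo P Mb R).dist y y') ∧
      (∀ a b : (oneScaleGeo P Mb R).Site, (oneScaleGeo P Mb R).dist a b = (oneScaleGeo P Mb R).dist b a) ∧
      1 ≤ (oneScaleGeo P Mb R).L ∧ 0 < (oneScaleGeo P Mb R).eta :=
  ⟨triangle254_oneScaleGeo P Mb R, fun y y' => T1_nonneg P P.K y y', dist_symm_oneScaleGeo P Mb R,
    by show (1 : ℝ) ≤ ((P.L : ℕ) : ℝ); exact_mod_cast P.hL.2.le, P.eps_pos⟩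

/-! ## §2. The lattice sum `Σ_{y′} e^{−αδ₀|y − y′|₁} ≤ c₀(α)^d` on the tower tori -/

/-- **`Σ_{y′ ∈ T^{(j)}} e^{−αδ₀|y − y′|₁} ≤ c₀(α)^d`** on the torus `T^{(j)} = Site P j = (ℤ/2L^{m+K−j})^d`: the exponential of the ℓ¹
distance factorises over the `d` coordinates (`Fintype.prod_sum` through `B5Ineq137Torus.siteEquiv`) and each factor is the one-dimensional
sum `Σ_{r∈ℤ/N}e^{−αδ₀dist(a − r, Nℤ)} ≤ c₀(α)` of `B6Lemma21OneScaleTorus.sum_exp_circAbs_le_c0` (c₀(α) = Σ_{z∈ℤ}e^{−αδ₀|z|}, p. 233).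
[cite: Balaban1984PropagatorsII, (2.61) p.234, count p.233] -/
theorem sum_exp_T1_le (j : ℕ) {δ₀ α : ℝ} (h : 0 < α * δ₀) (y : Site P j) :
    ∑ y' : Site P j, Real.exp (-(α * δ₀ * T1 P j y y')) ≤ B6.c0 δ₀ α ^ P.d := by
  set F : (μ : Fin P.d) → Fin (Nv P j μ) → ℝ :=
    fun μ r => Real.exp (-(α * δ₀ * ((circAbs (Nv P j μ) ((((toT y) μ).val : ℤ) - ((r : ℕ) : ℤ)) : ℤ) : ℝ))) with hF
  have hfac : ∀ y' : Site P j, Real.exp (-(α * δ₀ * T1 P j y y')) = ∏ μ, F μ ((siteEquiv P j) y' μ) := by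
    intro y'
    simp only [hF]
    rw [← Real.exp_sum]
    congr 1
    unfold T1
    rw [Nat.cast_sum, Finset.mul_sum, ← Finset.sum_neg_distrib]
    refine Finset.sum_congr rfl fun μ _ => ?_
    have hc : ((ccoord (Nv P j) (toT y) (toT y') μ : ℕ) : ℝ) =
        ((circAbs (Nv P j μ) ((((toT y) μ).val : ℤ) - ((((siteEquiv P j) y' μ : Fin (Nv P j μ)) : ℕ) : ℤ)) : ℤ) : ℝ) := by
      rw [← Int.cast_natCast, ccoord_cast (Nv_pos P j)]
      rfl
    rw [hc]
  have hc0 : ∀ μ : Fin P.d, 0 ≤ ∑ r : Fin (Nv P j μ), F μ r := fun μ => Finset.sum_nonneg fun r _ => (Real.exp_pos _).le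
  calc ∑ y' : Site P j, Real.exp (-(α * δ₀ * T1 P j y y'))
      = ∑ y' : Site P j, ∏ μ, F μ ((siteEquiv P j) y' μ) := Finset.sum_congr rfl fun y' _ => hfac y'
    _ = ∑ t : B4Sect5Torus.TSite P.d (Nv P j), ∏ μ, F μ (t μ) :=
        Fintype.sum_equiv (siteEquiv P j) _ _ (fun y' => rfl)
    _ = ∏ μ, ∑ r : Fin (Nv P j μ), F μ r := (Fintype.prod_sum F).symm
    _ ≤ ∏ _μ : Fin P.d, B6.c0 δ₀ α :=
        Finset.prod_le_prod (fun μ _ => hc0 μ) fun μ _ => sum_exp_circAbs_le_c0 (Nv_pos P j μ) h _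
    _ = B6.c0 δ₀ α ^ P.d := by rw [Finset.prod_const, Finset.card_univ, Fintype.card_fin]

/-! ## §3. Lemma 2.1, verbatim, on the one-scale torus family (site version on the tower carriers) -/

/-- **(2.60) on one scale is void**: all sites of `Λ_K = T₁^{(K)}` are at scale K, so `max{|j − j′| − 1, 0} = 0` and the right side
of (2.60) is `1 ≥ e^{−αδ₀d(y,y′)}` (`αδ₀ ≥ 0`). [cite: Balaban1984PropagatorsII, Lemma 2.1 (2.60) p.234] -/
theorem ineq260_oneScaleGeo (Mb R : ℕ) {δ₀ α : ℝ} (h : 0 ≤ α * δ₀) : Ineq260 (oneScaleGeo P Mb R) δ₀ α := by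
  intro y y'
  show Real.exp (-(α * δ₀ * T1 P P.K y y')) ≤
    Real.exp (-(α * δ₀ * (R : ℝ) * (Mb : ℝ) * max (|((P.K : ℕ) : ℝ) - ((P.K : ℕ) : ℝ)| - 1) 0))
  have h0 : max (|((P.K : ℕ) : ℝ) - ((P.K : ℕ) : ℝ)| - 1) 0 = 0 := by
    rw [sub_self, abs_zero, zero_sub]
    exact max_eq_right (by norm_num)
  rw [h0, mul_zero, neg_zero, Real.exp_zero]
  apply Real.exp_le_one_iff.mpr
  have hd := T1_nonneg P P.K y y'
  nlinarith

/-- **(2.61) on one scale WITH THE PRINTED CONSTANT**, uniformly in the volume: `Σ_{y′∈T₁^{(K)}} e^{−αδ₀d(y,y′)} ≤ c₀(α)^d ≤ c₀(½α)^d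
≤ 12c₀(½α)^d = c₁(α)` for every y (d(y,y′) = |y − y′|₁, `αδ₀ > 0`; `d = P.d`). [cite: Balaban1984PropagatorsII, Lemma 2.1 (2.61) p.234] -/
theorem ineq261_oneScaleGeo {d : ℕ} (hPd : P.d = d) (Mb R : ℕ) {δ₀ α : ℝ} (h : 0 < α * δ₀) :
    Ineq261 d (oneScaleGeo P Mb R) δ₀ α := by
  intro y
  show ∑ y' : Site P P.K, Real.exp (-(α * δ₀ * T1 P P.K y y')) ≤ B6.c1 d δ₀ α
  have hc : 0 ≤ B6.c0 δ₀ α := by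
    unfold B6.c0; exact tsum_nonneg fun z => (Real.exp_pos _).le
  have hc2 : 0 ≤ B6.c0 δ₀ (α / 2) := by
    unfold B6.c0; exact tsum_nonneg fun z => (Real.exp_pos _).le
  calc ∑ y' : Site P P.K, Real.exp (-(α * δ₀ * T1 P P.K y y'))
      ≤ B6.c0 δ₀ α ^ P.d := sum_exp_T1_le P P.K h y
    _ = B6.c0 δ₀ α ^ d := by rw [hPd]
    _ ≤ B6.c0 δ₀ (α / 2) ^ d := pow_le_pow_left₀ hc (c0_le_c0_half h) _
    _ ≤ 12 * B6.c0 δ₀ (α / 2) ^ d := le_mul_of_one_le_left (pow_nonneg hc2 _) (by norm_num)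
    _ = B6.c1 d δ₀ α := rfl

/-- **LEMMA 2.1, VERBATIM (`B6.Lemma21Printed`), ON THE ONE-SCALE TORUS FAMILY OF `B6Prop22OneScaleTorus`, WITH NO HYPOTHESIS BUT
`δ₀ > 0`**: for every `d`, `L` and every `δ₀ > 0` the census Prop — (2.60) ∧ (2.61) with the PRINTED `c₁(α) = 12c₀(½α)^d`, for all
`0 < α < 1` under (2.59) — holds for the family of all one-scale tori `Λ_K = T₁^{(K)} = Site P K` (`P.d = d`, `P.L = L`, `K ≥ 1`, all
volumes, all `Mb`, `R`) with the distance (2.46) (= periodic ℓ¹ distance on one scale).  ((2.59) is not used: on one scale (2.61) holds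
for every α, δ₀ > 0.) [cite: Balaban1984PropagatorsII, Lemma 2.1 (2.60)–(2.61) p.234; p.235 «If we have one scale, i.e. Λ_k = T₁^{(k)}»] -/
theorem lemma21Printed_towerTorus (d L : ℕ) {δ₀ : ℝ} (hδ₀ : 0 < δ₀) :
    B6.Lemma21Printed d δ₀ (fun i : Index d L => oneScaleGeo i.P i.Mb i.R) := by
  rw [lemma21Printed_iff]
  intro i _ α hα0 _ _
  have h : 0 < α * δ₀ := mul_pos hα0 hδ₀
  exact ⟨ineq260_oneScaleGeo i.P i.Mb i.R h.le, ineq261_oneScaleGeo i.P i.hPd i.Mb i.R h⟩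

/-- **ALL FOUR DISPLAYS (2.60)–(2.63) on the family** (the chains (2.62), (2.63) through the cell's `B6RandomWalk.lemma21_full`, which
needs only (2.61) and the triangle inequality (2.54) = `triangle254_oneScaleGeo`). [cite: Balaban1984PropagatorsII, Lemma 2.1 (2.60)–(2.63) p.234] -/
theorem lemma21_full_towerTorus (d L : ℕ) {δ₀ : ℝ} (hδ₀ : 0 < δ₀) (i : Index d L) {α : ℝ} (hα0 : 0 < α) (hα1 : α < 1)
    (h259 : B6.Cond259 d δ₀ α (i.R : ℝ) (i.Mb : ℝ)) :
    Ineq260 (oneScaleGeo i.P i.Mb i.R) δ₀ α ∧ Ineq261 d (oneScaleGeo i.P i.Mb i.R) δ₀ α ∧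
      Ineq262 d (oneScaleGeo i.P i.Mb i.R) δ₀ α ∧ Ineq263 d (oneScaleGeo i.P i.Mb i.R) δ₀ α :=
  lemma21_full d δ₀ hδ₀.le (fun i : Index d L => oneScaleGeo i.P i.Mb i.R) (fun i => triangle254_oneScaleGeo i.P i.Mb i.R)
    (lemma21Printed_towerTorus d L hδ₀) i trivial α hα0 hα1 h259

/-- **Non-vacuity of (2.59) on the family**: for every `d ≥ 1`, odd `L > 1`, every volume exponent `m`, scale `K ≥ 1`, big-block size
`Mb ≥ 1` and all `α, δ₀` with `αδ₀ > 0` there is a member (with these `m, K, Mb` and a suitable `R`, r03's `exists_cond259`) meeting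
`Hyp21_22` and (2.59) — so the conclusions of `lemma21_full_towerTorus` are asserted for members of the family, not vacuously.
[cite: Balaban1984PropagatorsII, (2.59) p.233 «Now we require that RM is sufficiently large», Lemma 2.1 p.234] -/
theorem towerTorus_meets_cond259 (d L : ℕ) (hd : 1 ≤ d) (hL : Odd L ∧ 1 < L) (m K : ℕ) (hK : 1 ≤ K) {Mb : ℕ} (hMb : 1 ≤ Mb)
    {δ₀ α : ℝ} (h : 0 < α * δ₀) :
    ∃ i : Index d L, i.P.m = m ∧ i.P.K = K ∧ i.Mb = Mb ∧ (oneScaleGeo i.P i.Mb i.R).Hyp21_22 ∧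
      B6.Cond259 d δ₀ α (oneScaleGeo i.P i.Mb i.R).R (oneScaleGeo i.P i.Mb i.R).M := by
  obtain ⟨R, hR⟩ := exists_cond259 d h
  exact ⟨⟨⟨⟨d, L, m, K, hd, hL⟩, rfl, rfl, hK⟩, Mb, R⟩, rfl, rfl, rfl, trivial, hR Mb hMb⟩

/-- **LEMMA 2.1 ∧ PROPOSITION 2.2, BOTH VERBATIM CENSUS PROPS, JOINTLY ON ONE FAMILY**: on the one-scale torus family (site version on
the tower carriers) `B6.Lemma21Printed d δ₀` (this file, every δ₀ > 0) and `B6.Prop22Printed` (p258648: the GENUINE `G′ = Δ′_a⁻¹ =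
(−Δ^η + m² + a_KQ′_K*Q′_K)⁻¹ = (B1RG242Torus.tower P a m²).G K`, all six quantities of (2.67), uniformly in K and in the volume) hold
together — two conjuncts of `B6.StatedBlock` inhabited genuinely on the same `B6.Geometry` family (d ≥ 1, odd L > 1, a > 0, m² ≥ 0).
[cite: Balaban1984PropagatorsII, Lemma 2.1 p.234, Prop. 2.2 (2.67) p.234] -/
theorem lemma21_and_prop22_oneScaleTorus (d L : ℕ) (hd : 1 ≤ d) (hL : Odd L ∧ 1 < L) {a : ℝ} (ha : 0 < a) {msq : ℝ}
    (hmsq : 0 ≤ msq) {δ₀ : ℝ} (hδ₀ : 0 < δ₀) :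
    B6.Lemma21Printed d δ₀ (fun i : Index d L => oneScaleGeo i.P i.Mb i.R) ∧
      B6.Prop22Printed (fun i : Index d L => oneScaleGeo i.P i.Mb i.R) (fun i => torusGp i.P a msq i.Mb i.R) :=
  ⟨lemma21Printed_towerTorus d L hδ₀, prop22Printed_oneScaleTorus d L hd hL ha hmsq⟩

end

end Literature.MathematicalPhysics.QuantumFieldTheory.Balaban1983to89.B6Lemma21TowerTorus
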